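import Summits.BirchSwinnertonDyer.Rank1Residual.X11b.RouteR1BDPValue
import Literature.FieldTheory.AlgClosed.PadicAlgClEquivComplex
import HarnessLib

/-!
# X11b, route R1 at `p ≥ 5` — the gen-21 record WITHOUT the auxiliary embedding datum:
# `BSD_p` on semistable `R1Population ∩ {r_an = 1}` from 8 PUBLISHED + 5 CITED facts and ONE OPEN
# input (H3, the anticyclotomic main conjecture for Castella's `L_p(f)`)

HONEST FRAMING (cell `b2b-bsdres`, run/shared/lean/b2b/bsd-rank1-residual/, verbatim in every
file): the goal of the cell is to DELETE the COMBINATION-SHAPED residual classes of the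
Birch–Swinnerton-Dyer formula for ALL analytic-rank `≤ 1` elliptic curves over `ℚ` — "full BSD
formula for every rank `≤ 1` curve in class `C`" assembled STRICTLY from published theorems — so
that the rank-`≤ 1` remainder becomes exactly the CONSTRUCTION-SHAPED classes, which are TYPED
(missing-input `Prop`s), NOT attempted. This is not "finishing BSD". Sub-cell
`b2b-bsdres-multr1-p1` (X11b, route R1, gen 21); a RESEARCH ROUTE; no claim beyond the stated
class; X11b stays CONSTRUCTION-SHAPED; nothing here changes a label; theorems only (no definition,
no named fact, no `sorry`); every result using the OPEN shape H3 is CONDITIONAL.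

## What this file does

`RouteR1BDPValue.lean` (gen 21) proves route R1's open input on semistable pairs from the PUBLISHED
facts and the ONE OPEN input H3, for a GIVEN embedding datum `ι : ℚ̄_p ≃+* ℂ` (Castella–Hsieh's
`ι_∞ ∘ ι_p⁻¹`). Such a datum EXISTS unconditionally (Steinitz: two algebraically closed fields of
characteristic `0` and cardinality `𝔠` are isomorphic — the tree's
`PadicAlgCl.nonempty_ringEquiv_complex`), so the binder is discharged:

* `R1.openInputOnTreeAt_of_imcEq'` — `R1OpenInputOnTreeAt W p` on a semistable pair from `h32`
  (Cas18 Thms. 3.1–3.2), `hmod`, `hGZK`, the five cited control facts and H3; no datum.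
* **`R1.bsdp_of_imcEq_record`** — THE RECORD of route R1 at `p ≥ 5` after gen 21: for every globally
  minimal SEMISTABLE elliptic `W/ℚ` and prime `p` on `R1Population` with `ord_{s=1} L(E,s) = 1`,
  `BSD(E,p)` from EIGHT PUBLISHED named facts (Gross–Zagier 1986 I.7.3, Gross–Zagier–Kolyvagin,
  Skinner 2016 Thm. C, modularity, Cai–Shu–Tian 2014 Thm. 1.1, Friedberg–Hoffstein 1995 Thm. B,
  Mazur 1978 Cor. 4.1, Castella 2018 Thms. 3.1–3.2), FIVE CITED cohomological facts (Poitou–Tate for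
  Selmer structures, `Ш¹ ↔ Ш¹(dual)`, local Euler–Poincaré, `cd_p ≤ 2`, Brink), and ONE OPEN input
  `R1.IMCEqOnTree W p` (erratum Thm. 1.1: `Ch_Λ(X_ac(E[p^∞]))·Λ_{R₀} = (L_p(f))` ⇐ [FW21, Thm. 4.41],
  PREPRINT). Nothing else.
* `R1.bsdp_iff_of_imcEq_record` — under the same published/cited facts, on semistable
  `R1Population ∩ {r_an = 1}`: H3 ⟹ (`R1OpenInputOnTreeAt W p ↔ BSDp W p` is gen 19's tightness, and
  both sides HOLD).

CONDITIONAL on H3 (open); deletes nothing; X11b stays CONSTRUCTION-SHAPED; no label change.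

References: [Castella2018] Thms. 2.3, 3.1, 3.2, §5 (arXiv:1704.06608 pp. 5, 9, 12);
[Castella2018Erratum] Thm. 1.1, Thm. A′ (p. 1); [FouquetWan2021] Thm. 4.41.
-/

noncomputable section

open scoped Classical

open WeierstrassCurve NumberField IsDedekindDomain Field
open Literature.NumberTheory.EllipticCurves Literature.NumberTheory.EllipticCurves.GreenbergSelmer
open Literature.NumberTheory.EllipticCurves.ModularForms
open Literature.NumberTheory.EllipticCurves.Rank1Residual
open Literature.NumberTheory.EllipticCurves.Rank1Residual.Typed
open Literature.NumberTheory.EllipticCurves.Castella2018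
open Literature.NumberTheory.GaloisRepresentations
open Literature.NumberTheory.GaloisCohomology

namespace Summit.BirchSwinnertonDyer.Rank1Residual.X11b

section Record

variable {W : WeierstrassCurve ℚ} [W.IsElliptic] [W.IsGloballyMinimal] {p : ℕ} [Fact p.Prime]

/-- **Route R1's open input from print ∧ H3 on a semistable pair — no embedding datum.** As
`R1.openInputOnTreeAt_of_imcEq`, with the datum `ι : ℚ̄_p ≃+* ℂ` supplied by Steinitz's theorem
(`PadicAlgCl.nonempty_ringEquiv_complex`). CONDITIONAL on H3 (open).
[cite: Castella2018, Thms. 2.3, 3.1, 3.2 and §5 (arXiv:1704.06608 pp. 5, 9, 12)]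
[cite: Castella2018Erratum, Thm. 1.1 (p. 1)] -/
theorem R1.openInputOnTreeAt_of_imcEq' (h32 : thm32_exists_isBDPLFunction_valueAtOne)
    (hmod : exists_isNewformOf) (hGZK : rank_eq_analyticRank_of_analyticRank_le_one)
    (hPT : ∀ (K : Type) [Field K] [NumberField K], poitouTate_selmerStructure_duality K)
    (hPT2 : ∀ (K : Type) [Field K] [NumberField K], poitouTate_sha_tateDual K)
    (hEP : ∀ (K : Type) [Field K] [NumberField K] (v : HeightOneSpectrum (𝓞 K)),
      localEulerPoincareCharacteristic (v.adicCompletion K))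
    (hcd : fieldCdLE_two_of_numberField)
    (hBr : ∀ (K : Type) [Field K] [NumberField K] (p : ℕ) [Fact p.Prime],
      ZpExtension.decomp_not_le_kerSubgroup_of_isAnticyclotomic K p)
    (hss : Semistable W) (h3 : R1.IMCEqOnTree W p) : R1OpenInputOnTreeAt W p := by
  obtain ⟨ι⟩ := PadicAlgCl.nonempty_ringEquiv_complex p
  exact R1.openInputOnTreeAt_of_imcEq h32 hmod hGZK hPT hPT2 hEP hcd hBr ι hss h3

/-- **Route R1 — THE RECORD after gen 21 (semistable pairs, `p ≥ 5`): 8 PUBLISHED + 5 CITED + 1 OPEN,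
no auxiliary datum.** For every globally minimal SEMISTABLE elliptic `W/ℚ` and prime `p` on
`R1Population` with `ord_{s=1} L(E,s) = 1`: `BSD(E,p)`, from the EIGHT PUBLISHED named facts `hGZ`
(Gross–Zagier 1986 I.7.3), `hGZK` (Gross–Zagier–Kolyvagin), `hSk` (Skinner 2016 Thm. C), `hmod`
(modularity), `hCST` (Cai–Shu–Tian 2014 Thm. 1.1), `hFH` (Friedberg–Hoffstein 1995 Thm. B), `hMaz`
(Mazur 1978 Cor. 4.1), `h32` (Castella 2018 Thms. 3.1–3.2: `L_p(f) ∈ Λ_{R₀}` exists with its value at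
`𝟙`), the FIVE CITED cohomological facts `hPT hPT2 hEP hcd hBr`, and the ONE OPEN input `h3 :
R1.IMCEqOnTree W p` (erratum Thm. 1.1 — the anticyclotomic main conjecture for Castella's published
`L_p(f)`, ⇐ [FW21, Thm. 4.41], PREPRINT). CONDITIONAL; deletes nothing; X11b stays
CONSTRUCTION-SHAPED; no label change. [cite: Castella2018, §5 (arXiv:1704.06608 p. 12)]
[cite: Castella2018Erratum, Thm. 1.1, Thm. A′ (p. 1)] -/
theorem R1.bsdp_of_imcEq_record
    (hGZ : GrossZagier1986_thm_I_7_3) (hGZK : rank_eq_analyticRank_of_analyticRank_le_one)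
    (hSk : Skinner2016.thmC_padicValRat_bsd_rank_zero) (hmod : exists_isNewformOf)
    (hCST : CaiShuTian2014.thm11_trivialChar)
    (hFH : friedbergHoffstein_exists_twist_ne_zero_ramifiedAt)
    (hMaz : mazur_not_dvd_maninConstant_of_odd) (h32 : thm32_exists_isBDPLFunction_valueAtOne)
    (hPT : ∀ (K : Type) [Field K] [NumberField K], poitouTate_selmerStructure_duality K)
    (hPT2 : ∀ (K : Type) [Field K] [NumberField K], poitouTate_sha_tateDual K)
    (hEP : ∀ (K : Type) [Field K] [NumberField K] (v : HeightOneSpectrum (𝓞 K)),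
      localEulerPoincareCharacteristic (v.adicCompletion K))
    (hcd : fieldCdLE_two_of_numberField)
    (hBr : ∀ (K : Type) [Field K] [NumberField K] (p : ℕ) [Fact p.Prime],
      ZpExtension.decomp_not_le_kerSubgroup_of_isAnticyclotomic K p)
    (hss : Semistable W) (h3 : R1.IMCEqOnTree W p) (hW : R1Population W p)
    (hr : W.analyticRank = 1) : BSDp W p := by
  obtain ⟨ι⟩ := PadicAlgCl.nonempty_ringEquiv_complex p
  exact R1.bsdp_of_imcEq_final hGZ hGZK hSk hmod hCST hFH hMaz h32 hPT hPT2 hEP hcd hBr ι hss h3 hW hr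

/-- **Both sides of gen 19's tightness hold**, under the published/cited facts and H3, on semistable
`R1Population ∩ {r_an = 1}`: the open input `R1OpenInputOnTreeAt W p` AND `BSDp W p`.
CONDITIONAL on H3 (open). [cite: Castella2018, §5 (arXiv:1704.06608 p. 12)]
[cite: Castella2018Erratum, Thm. 1.1 (p. 1)] -/
theorem R1.openInput_and_bsdp_of_imcEq_record
    (hGZ : GrossZagier1986_thm_I_7_3) (hGZK : rank_eq_analyticRank_of_analyticRank_le_one)
    (hSk : Skinner2016.thmC_padicValRat_bsd_rank_zero) (hmod : exists_isNewformOf)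
    (hCST : CaiShuTian2014.thm11_trivialChar)
    (hFH : friedbergHoffstein_exists_twist_ne_zero_ramifiedAt)
    (hMaz : mazur_not_dvd_maninConstant_of_odd) (h32 : thm32_exists_isBDPLFunction_valueAtOne)
    (hPT : ∀ (K : Type) [Field K] [NumberField K], poitouTate_selmerStructure_duality K)
    (hPT2 : ∀ (K : Type) [Field K] [NumberField K], poitouTate_sha_tateDual K)
    (hEP : ∀ (K : Type) [Field K] [NumberField K] (v : HeightOneSpectrum (𝓞 K)),
      localEulerPoincareCharacteristic (v.adicCompletion K))
    (hcd : fieldCdLE_two_of_numberField)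
    (hBr : ∀ (K : Type) [Field K] [NumberField K] (p : ℕ) [Fact p.Prime],
      ZpExtension.decomp_not_le_kerSubgroup_of_isAnticyclotomic K p)
    (hss : Semistable W) (h3 : R1.IMCEqOnTree W p) (hW : R1Population W p)
    (hr : W.analyticRank = 1) : R1OpenInputOnTreeAt W p ∧ BSDp W p :=
  ⟨R1.openInputOnTreeAt_of_imcEq' h32 hmod hGZK hPT hPT2 hEP hcd hBr hss h3,
    R1.bsdp_of_imcEq_record hGZ hGZK hSk hmod hCST hFH hMaz h32 hPT hPT2 hEP hcd hBr hss h3 hW hr⟩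

end Record

end Summit.BirchSwinnertonDyer.Rank1Residual.X11b

end
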